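import Mathlib
import Mathlib.Analysis.InnerProductSpace.GramSchmidtOrtho
import Mathlib.Analysis.Asymptotics.Defs
import Mathlib.Analysis.SpecialFunctions.Log.Basic
import Mathlib.Data.Nat.Sqrt
import Literature.Algebra.EuclideanLattices.Problems
import Literature.Algebra.EuclideanLattices.Encoding
import Literature.Computability.Cryptography.LWE
import Literature.Computability.Cryptography.LWENoise
import Literature.Computability.Cryptography.PQCLWE
import Literature.Algebra.EuclideanLattices.LatticeComplexity
import Literature.Computability.Complexity.BoolEncodings
import Literature.Computability.Complexity.Oracle
import Literature.Computability.Cryptography.OracleGames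
import Literature.Computability.Cryptography.QuantumCircuit
import Literature.Computability.Cryptography.ClassBQP
import HarnessLib.Audit
import Literature.Computability.Cryptography.LWEHardness
import HarnessLib

/-!
# LWEInBQP — CONJECTURE (obligation of PneNP/PneNP)

Unproven conjecture migrated by the gate from `Literature/Computability/Cryptography/LWEHardness.lean` (`Literature.Computability.Cryptography.LWEInBQP`): unproven conjectures are obligations of our
theories, not literature facts (human ruling 2026-08-15). Provenance: Regev2009. Routes use it as a crux item or via
`--conditional-bridge --conditional-on LWEInBQP`; a proof goes in the sibling `Theorems/LWEInBQPHolds.lean` as `theorem LWEInBQP_holds : LWEInBQP` so this file stays a conjecture LEAF that Literature/ may import.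
-/

namespace Summit.PneNP.PneNP

open Literature Literature.Computability Literature.Computability.Cryptography
open Filter Asymptotics Computability Literature.Computability.Complexity Literature.Computability.Cryptography.LWE Literature.Algebra.EuclideanLattices Literature.Computability.Cryptography
open scoped ENNReal
open Literature.Computability.Complexity (Oracle)
open Literature.Computability.Complexity.Oracle
open Literature.Algebra.EuclideanLattices

/-- OPEN CONJECTURE — **pqc.S02** (`LWE ∈ BQP` for some parameter family in Regev's polynomial
regime; summits/fw-lwe-bqp/SUMMIT.md). This is the NEGATION of the open conjecture `LWENotInBQP`
(`lweInBQP_iff_not_lweNotInBQP`): exactly one of the two holds and neither is known. POSED as an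
open question in Regev 2009, §1 (J. ACM 56(6), art. 34; arXiv:2401.03703, p. 4): "one could also
interpret our main theorem as a way to disprove this conjecture: if one finds an efficient
algorithm for LWE, then one also obtains a quantum algorithm for approximating worst-case lattice
problems. Such a result would be of tremendous importance on its own." It is NOT a theorem of
Regev 2009 (whose Thm 1.1 is the reduction `regev_lwe_to_sivp_quantum`, pqc.S19): no polynomial
time quantum (or classical) algorithm for LWE is known — the best known algorithm takes `2^{O(n)}`
equations/time (ibid., p. 3) — and Regev guesses the opposite direction (ibid., p. 4, footnote).
Registered OPEN statement, not literature debt: no `LWEInBQP_holds` is expected (defact verdict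
2026-08-15, open-problem); the name is kept because `lweInBQP_iff_not_lweNotInBQP` and the module
docstring of `LWEHardnessProofs` refer to it.
STATEMENT. There are `q`, `α`, `c₀` in Regev's regime, a polynomially bounded `m` and a
polynomial-time uniform quantum circuit family (G11) solving search-`LWE_{q(n), Ψ̄_{α(n)}}` from
`m n` samples with average-case success probability `≥ 2/3` for all large `n`.
[cite: Regev2009, §1 (arXiv:2401.03703 p. 4; open question)] [status: open] -/
@[conjecture] def LWEInBQP : Prop :=
  ∃ (q : ℕ → ℕ) (α : ℕ → ℝ) (c₀ : ℕ) (m : ℕ → ℕ) (h : RegevRegime q α c₀), IsPolyBounded m ∧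
    haveI := h.neZero
    ∃ Q : UniformQCircuitFamily, SearchLWESolves q (fun n => discretizedGaussian (q n) (α n)) m
      (fun n => Q.searchLWESolver n (q n) (m n)) fun _ => 2 / 3

end Summit.PneNP.PneNP
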